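import Literature.Probability.RandomPlanarGeometry.SAWLoopErasureMemoryTwoFirstStep
import HarnessLib

/-!
# The first-hit cut for memory-2 walks with a taboo site — Hara–Slade–Sokal (3.10)–(3.13) at coefficient level

Hara, Slade and Sokal [HSS93, §3.2 p. 17–18] evaluate the taboo two-point function `C^{A∪{b}}₂(y,x;β)` of the
memory-2 (non-backtracking) walk by cutting a walk that does visit `b` at the FIRST time it hits `b`. As printed:

* (3.10) `C^{A∪{b}}₂(y,x;β) = C^A₂(y,x;β) − Σ_{ω: y→x, ω∩A=∅, ω∋b} β^{|ω|}`;
* (3.11) the subtracted sum equals `Σ_{f:|f|=1} β Σ_{ω'₁: y→b+f, ω'₁∩A=∅} β^{|ω'₁|} I[ω'₁ ∌ b] Σ_{ω₂: b→x, ω₂∩A=∅} β^{|ω₂|} I[ω₂(1) ≠ b+f]`,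
  "the sum over ω'₁ exactly gives C^{A∪{b}}₂(y,b+f;β)";
* (3.12) removes the first-step constraint (module `SAWLoopErasureMemoryTwoFirstStep`), and the net result is
* (3.13) `C^{A∪{b}}₂(y,x;β) = C^A₂(y,x;β) − (β/(1−β²)) Σ_{|f|=1} C^{A∪{b}}₂(y,b+f;β)·[C^A₂(b,x;β) − βC^A₂(b+f,x;β)]`.

This module proves the COEFFICIENT-LEVEL content of (3.10)–(3.11) for walks from the origin (`y = 0`), over the
tree's `nbwAvoidTo A x n` (the `n`-step non-backtracking walks `0 → x` avoiding `A`) and `nbwAvoidToFirst` (those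
with a forbidden first step). Writing the last step before the hit as `g` (so that HSS's `f` is `−g`, `b + f = b − e_g`)
and translating the piece after the hit to start at the origin (`tabooShiftBy A b = A − b`):

* `card_nbwAvoidTo_eq_card_insert_add_sum` — (3.10): `c_n(A,x) = c_n(A∪{b},x) + Σ_{τ=1}^{n} #nbwFirstHit_τ` for `b ≠ 0`,
  where `nbwFirstHit A b x n τ` are the walks of `nbwAvoidTo A x n` whose first visit to `b` is at time `τ`;
* `card_nbwFirstHit` — (3.11): `#nbwFirstHit A b x (m+1+k) (m+1) = Σ_g c_m(A∪{b}, b − e_g) · N_k(A − b, x − b, −g)` for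
  `b ∉ A` (a bijection `(g, ζ, η) ↦ (ζ·g)·η`, `nbwFirstHit_eq_image`), with `N_k` = `#nbwAvoidToFirst`;
* `card_nbwAvoidTo_first_hit_expansion` — both combined: for `b ≠ 0`, `b ∉ A`,
  `c_n(A,x) = c_n(A∪{b},x) + Σ_{m<n} Σ_g c_m(A∪{b}, b − e_g) · N_{n−1−m}(A − b, x − b, −g)`;
* `sum_card_nbwAvoidTo_mul_pow_eq` — the same for truncated generating functions:
  `C_{K+1}(A,x;β) = C_{K+1}(A∪{b},x;β) + β Σ_g Σ_{m≤K} c_m(A∪{b}, b−e_g) β^m · Σ_{k≤K−m} N_k β^k` (exact, triangular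
  truncation), which with (3.12) (`sum_nbwAvoidToFirst_add_two_eq`) is (3.13) before passing to the limit.
-/

noncomputable section

namespace Literature.Probability.RandomPlanarGeometry.SAW.Zd.LoopErasure

open Finset
open scoped BigOperators
open Literature.Probability.LatticeModels Literature.Probability.LatticeModels.SRW
open Literature.Barriers.CriticalPhenomena.SAWLace (pos_append_of_le pos_append_add)
open Literature.Probability.Percolation (IsNBW srev srev_srev)

variable {d : ℕ}

/-! ### Appending walks: plumbing -/

/-- `(u·v)_i = u_i` for `i < a`. [cite: MadrasSlade1993, §1.2 (p. 10) (step words, concatenation; lane plumbing)] -/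
theorem stepSeq_append_apply_lt {a k : ℕ} (u : StepSeq d a) (v : StepSeq d k) {i : ℕ} (hi : i < a)
    (h : i < a + k) : (Fin.append u v : StepSeq d (a + k)) ⟨i, h⟩ = u ⟨i, hi⟩ := by
  have e : (⟨i, h⟩ : Fin (a + k)) = Fin.castAdd k ⟨i, hi⟩ := rfl
  rw [e, Fin.append_left]

/-- `(u·v)_{a+j} = v_j`. [cite: MadrasSlade1993, §1.2 (p. 10) (step words, concatenation; lane plumbing)] -/
theorem stepSeq_append_apply_add {a k : ℕ} (u : StepSeq d a) (v : StepSeq d k) {j : ℕ} (hj : j < k)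
    (h : a + j < a + k) : (Fin.append u v : StepSeq d (a + k)) ⟨a + j, h⟩ = v ⟨j, hj⟩ := by
  have e : (⟨a + j, h⟩ : Fin (a + k)) = Fin.natAdd a ⟨j, hj⟩ := rfl
  rw [e, Fin.append_right]

/-- `u·v` is non-backtracking iff both pieces are and the first step of `v` does not reverse the last step of `u`.
[cite: MadrasSlade1993, §1.2 (memory 2 rules out immediate reversals; lane plumbing)] -/
theorem isNBW_append_iff {a k : ℕ} (u : StepSeq d a) (v : StepSeq d k) :
    IsNBW (Fin.append u v : StepSeq d (a + k)) ↔
      IsNBW u ∧ IsNBW v ∧ ∀ (i : Fin a) (j : Fin k), (i : ℕ) + 1 = a → (j : ℕ) = 0 → v j ≠ srev (u i) := by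
  have hu : ∀ (i : ℕ) (hi : i < a), (Fin.append u v : StepSeq d (a + k)) ⟨i, by omega⟩ = u ⟨i, hi⟩ :=
    fun i hi => stepSeq_append_apply_lt u v hi _
  have hv : ∀ (j : ℕ) (hj : j < k), (Fin.append u v : StepSeq d (a + k)) ⟨a + j, by omega⟩ = v ⟨j, hj⟩ :=
    fun j hj => stepSeq_append_apply_add u v hj _
  constructor
  · intro h
    refine ⟨fun m hm => ?_, fun m hm => ?_, fun i j hi hj => ?_⟩
    · have h1 := h m (by omega)
      rwa [hu _ hm, hu _ (show m < a by omega)] at h1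
    · have h1 := h (a + m) (by omega)
      have e1 : (Fin.append u v : StepSeq d (a + k)) ⟨a + m + 1, by omega⟩ = v ⟨m + 1, hm⟩ := hv (m + 1) hm
      have e2 : (Fin.append u v : StepSeq d (a + k)) ⟨a + m, by omega⟩ = v ⟨m, by omega⟩ := hv m (by omega)
      rw [e1, e2] at h1
      exact h1
    · have hk : 0 < k := by have := j.2; omega
      have h1 := h i (by omega)
      have e1 : (⟨(i : ℕ) + 1, (by omega : (i : ℕ) + 1 < a + k)⟩ : Fin (a + k)) = ⟨a + 0, by omega⟩ :=
        Fin.ext (by simp only; omega)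
      have e2 : (Fin.append u v : StepSeq d (a + k)) ⟨(i : ℕ), by omega⟩ = u i := hu i i.2
      have e3 : j = ⟨0, hk⟩ := Fin.ext hj
      rw [e1, hv 0 hk, e2] at h1
      rw [e3]
      exact h1
  · rintro ⟨hU, hV, hJ⟩ m hm
    rcases Nat.lt_or_ge (m + 1) a with hlt | hge
    · rw [hu _ hlt, hu _ (show m < a by omega)]
      exact hU m hlt
    · rcases Nat.eq_or_lt_of_le hge with heq | hgt
      · -- the joint: `m + 1 = a`
        have hk : 0 < k := by omega
        have e1 : (⟨m + 1, hm⟩ : Fin (a + k)) = ⟨a + 0, by omega⟩ := Fin.ext (by simp only; omega)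
        rw [e1, hv 0 hk, hu m (by omega)]
        exact hJ ⟨m, by omega⟩ ⟨0, hk⟩ heq.symm rfl
      · obtain ⟨j, rfl⟩ : ∃ j, m = a + j := ⟨m - a, by omega⟩
        have e1 : (⟨a + j + 1, hm⟩ : Fin (a + k)) = ⟨a + (j + 1), by omega⟩ := rfl
        rw [e1, hv (j + 1) (by omega), hv j (by omega)]
        exact hV j (by omega)

/-! ### The obstacle and the target seen from the taboo site -/

/-- `A − b`: the obstacle set translated so that the taboo site `b` becomes the origin.
[cite: HaraSladeSokal1993, §3.2 eq. (3.11) p. 18 (the walks ω₂ from b; lane plumbing)] -/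
def tabooShiftBy (A : Finset (Site d)) (b : Site d) : Finset (Site d) :=
  A.image fun a => a - b

/-- Membership in `tabooShiftBy`. [cite: HaraSladeSokal1993, §3.2 eq. (3.11) p. 18 (lane plumbing)] -/
theorem mem_tabooShiftBy {A : Finset (Site d)} {b y : Site d} : y ∈ tabooShiftBy A b ↔ y + b ∈ A := by
  classical
  rw [tabooShiftBy, Finset.mem_image]
  constructor
  · rintro ⟨a, ha, rfl⟩
    rwa [sub_add_cancel]
  · intro h
    exact ⟨y + b, h, add_sub_cancel_right _ _⟩

/-- `0 ∈ A − b ↔ b ∈ A`. [cite: HaraSladeSokal1993, §3.2 eq. (3.11) p. 18 (lane plumbing)] -/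
theorem zero_mem_tabooShiftBy_iff {A : Finset (Site d)} {b : Site d} : (0 : Site d) ∈ tabooShiftBy A b ↔ b ∈ A := by
  rw [mem_tabooShiftBy, zero_add]

/-- The shift by a unit vector of `SAWLoopErasureMemoryTwoFirstStep` is the case `b = e_f`.
[cite: HaraSladeSokal1993, §3.2 eq. (3.11)–(3.12) p. 18 (lane plumbing)] -/
theorem tabooShift_eq_tabooShiftBy (A : Finset (Site d)) (f : Dir d) : tabooShift A f = tabooShiftBy A (stepVec f) := rfl

/-! ### Walks whose first visit to `b` is at a given time -/

open Classical in
/-- The walks of `nbwAvoidTo A x n` whose FIRST visit to `b` happens at time `τ`.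
[cite: HaraSladeSokal1993, §3.2 eq. (3.10)–(3.11) p. 17–18 ("cut the walk at the first time it hits b")] -/
def nbwFirstHit (A : Finset (Site d)) (b x : Site d) (n τ : ℕ) : Finset (StepSeq d n) :=
  (nbwAvoidTo A x n).filter fun ω => pos ω τ = b ∧ ∀ t < τ, pos ω t ≠ b

/-- Membership in `nbwFirstHit`. [cite: HaraSladeSokal1993, §3.2 eq. (3.10)–(3.11) p. 17–18 (lane plumbing)] -/
theorem mem_nbwFirstHit {A : Finset (Site d)} {b x : Site d} {n τ : ℕ} {ω : StepSeq d n} :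
    ω ∈ nbwFirstHit A b x n τ ↔ ω ∈ nbwAvoidTo A x n ∧ pos ω τ = b ∧ ∀ t < τ, pos ω t ≠ b := by
  classical
  rw [nbwFirstHit, Finset.mem_filter]

/-- Transport of `#nbwFirstHit` along an equality of lengths. [cite: HaraSladeSokal1993, §3.2 eq. (3.11) p. 18 (lane plumbing)] -/
theorem card_nbwFirstHit_congr {A : Finset (Site d)} {b x : Site d} {n n' : ℕ} (h : n = n') (τ : ℕ) :
    (nbwFirstHit A b x n τ).card = (nbwFirstHit A b x n' τ).card := by
  subst h
  rfl

/-! ### (3.10): walks avoiding `A` either avoid `b` too or have a first visit to `b` -/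

/-- The walks of `nbwAvoidTo A x n` that never visit `b` are `nbwAvoidTo (A ∪ {b}) x n`.
[cite: HaraSladeSokal1993, §3.2 eq. (3.10) p. 17] -/
theorem filter_nbwAvoidTo_not_visit_eq (A : Finset (Site d)) (b x : Site d) (n : ℕ) :
    ((nbwAvoidTo A x n).filter fun ω => ∀ t ≤ n, pos ω t ≠ b) = nbwAvoidTo (insert b A) x n := by
  classical
  ext ω
  rw [Finset.mem_filter, mem_nbwAvoidTo, mem_nbwAvoidTo]
  constructor
  · rintro ⟨⟨⟨hn, hav⟩, he⟩, hb⟩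
    refine ⟨⟨hn, fun t ht h => ?_⟩, he⟩
    rcases Finset.mem_insert.1 h with h | h
    · exact hb t ht h
    · exact hav t ht h
  · rintro ⟨⟨hn, hav⟩, he⟩
    exact ⟨⟨⟨hn, fun t ht h => hav t ht (Finset.mem_insert_of_mem h)⟩, he⟩,
      fun t ht h => hav t ht (h ▸ Finset.mem_insert_self b A)⟩

/-- The walks of `nbwAvoidTo A x n` that do visit `b ≠ 0` split according to their first visit time `τ ∈ [1, n]`.
[cite: HaraSladeSokal1993, §3.2 eq. (3.10)–(3.11) p. 17–18] -/
theorem filter_nbwAvoidTo_visit_eq_biUnion {A : Finset (Site d)} {b : Site d} (hb0 : b ≠ 0) (x : Site d) (n : ℕ) :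
    ((nbwAvoidTo A x n).filter fun ω => ¬ ∀ t ≤ n, pos ω t ≠ b) =
      (range n).biUnion fun τ => nbwFirstHit A b x n (τ + 1) := by
  classical
  ext ω
  simp only [Finset.mem_filter, Finset.mem_biUnion, Finset.mem_range, mem_nbwFirstHit]
  constructor
  · rintro ⟨hω, hvis⟩
    push Not at hvis
    obtain ⟨T, hTn, hT⟩ := hvis
    have hex : ∃ t, t ≤ n ∧ pos ω t = b := ⟨T, hTn, hT⟩
    have hspec := Nat.find_spec hex
    have hmin : ∀ t < Nat.find hex, pos ω t ≠ b := fun t ht h =>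
      Nat.find_min hex ht ⟨(le_of_lt ht).trans hspec.1, h⟩
    have hT0 : Nat.find hex ≠ 0 := by
      intro h0
      have h2 := hspec.2
      rw [h0, pos_zero] at h2
      exact hb0 h2.symm
    refine ⟨Nat.find hex - 1, by omega, hω, ?_, ?_⟩
    · rw [Nat.sub_add_cancel (Nat.pos_of_ne_zero hT0)]
      exact hspec.2
    · rw [Nat.sub_add_cancel (Nat.pos_of_ne_zero hT0)]
      exact hmin
  · rintro ⟨τ, hτ, hω, hpos, -⟩
    exact ⟨hω, fun h => h (τ + 1) (by omega) hpos⟩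

/-- **(3.10) counted**: `c_n(A,x) = c_n(A ∪ {b}, x) + Σ_{τ=1}^{n} #nbwFirstHit_τ` for `b ≠ 0`.
[cite: HaraSladeSokal1993, §3.2 eq. (3.10) p. 17] -/
theorem card_nbwAvoidTo_eq_card_insert_add_sum {A : Finset (Site d)} {b : Site d} (hb0 : b ≠ 0) (x : Site d)
    (n : ℕ) :
    (nbwAvoidTo A x n).card =
      (nbwAvoidTo (insert b A) x n).card + ∑ τ ∈ range n, (nbwFirstHit A b x n (τ + 1)).card := by
  classical
  rw [← filter_nbwAvoidTo_not_visit_eq A b x n,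
    ← Finset.card_filter_add_card_filter_not (s := nbwAvoidTo A x n) (fun ω => ∀ t ≤ n, pos ω t ≠ b),
    filter_nbwAvoidTo_visit_eq_biUnion hb0 x n, Finset.card_biUnion]
  intro τ _ τ' _ hne
  refine Finset.disjoint_left.2 fun ω h1 h2 => ?_
  rw [mem_nbwFirstHit] at h1 h2
  rcases Nat.lt_or_gt_of_ne hne with h | h
  · exact h2.2.2 (τ + 1) (by omega) h1.2.1
  · exact h1.2.2 (τ' + 1) (by omega) h2.2.1

/-! ### (3.11): the first-hit bijection -/

/-- `(g, ζ, η) ↦ (ζ·g)·η` is injective. [cite: HaraSladeSokal1993, §3.2 eq. (3.11) p. 18 (lane plumbing)] -/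
theorem append_snoc_injective (m k : ℕ) :
    Function.Injective fun p : (Σ _ : Dir d, StepSeq d m × StepSeq d k) =>
      (Fin.append (Fin.snoc p.2.1 p.1 : StepSeq d (m + 1)) p.2.2 : StepSeq d (m + 1 + k)) := by
  rintro ⟨g, ζ, η⟩ ⟨g', ζ', η'⟩ h
  have h1 : ((Fin.snoc ζ g : StepSeq d (m + 1)), η) = ((Fin.snoc ζ' g' : StepSeq d (m + 1)), η') :=
    (Fin.appendEquiv (m + 1) k).injective h
  obtain ⟨hs, hη⟩ := Prod.mk.inj h1
  have hζ : ζ = ζ' := by simpa [Fin.init_snoc] using congrArg Fin.init hs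
  have hg : g = g' := by simpa [Fin.snoc_last] using congrFun hs (Fin.last m)
  subst hζ hg hη
  rfl

/-- **The first-hit cut as a bijection**: a walk of `nbwAvoidTo A x (m+1+k)` first visiting `b ∉ A` at time `m+1`
is exactly `(ζ·g)·η` with `ζ ∈ nbwAvoidTo (A ∪ {b}) (b − e_g) m` (the piece before the hit, HSS's `ω'₁` to `b+f`,
`f = −g`), `g` the step onto `b`, and `η` a walk `0 → x − b` avoiding `A − b` whose first step is not `−g`
(HSS's `ω₂` translated, `I[ω₂(1) ≠ b+f]`). [cite: HaraSladeSokal1993, §3.2 eq. (3.11) p. 18] -/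
theorem nbwFirstHit_eq_image {A : Finset (Site d)} {b : Site d} (hbA : b ∉ A) (x : Site d) (m k : ℕ) :
    nbwFirstHit A b x (m + 1 + k) (m + 1) =
      (((Finset.univ : Finset (Dir d)).sigma fun g =>
          nbwAvoidTo (insert b A) (b - stepVec g) m ×ˢ nbwAvoidToFirst (tabooShiftBy A b) (x - b) (srev g) k).image
        fun p => (Fin.append (Fin.snoc p.2.1 p.1 : StepSeq d (m + 1)) p.2.2 : StepSeq d (m + 1 + k))) := by
  classical
  ext ω
  rw [mem_nbwFirstHit, mem_nbwAvoidTo, Finset.mem_image]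
  constructor
  · rintro ⟨⟨⟨hnbw, hav⟩, hend⟩, hhit, hbefore⟩
    set u : StepSeq d (m + 1) := ((Fin.appendEquiv (m + 1) k).symm ω).1 with hu_def
    set η : StepSeq d k := ((Fin.appendEquiv (m + 1) k).symm ω).2 with hη_def
    have hω : Fin.append u η = ω := (Fin.appendEquiv (m + 1) k).apply_symm_apply ω
    set g : Dir d := u (Fin.last m) with hg_def
    set ζ : StepSeq d m := Fin.init u with hζ_def
    have hu : (Fin.snoc ζ g : StepSeq d (m + 1)) = u := Fin.snoc_init_self u
    -- positions
    have hposζ : ∀ t ≤ m, pos ζ t = pos ω t := fun t ht => by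
      rw [← pos_snoc_of_le ζ g ht, hu, ← hω, pos_append_of_le u η (show t ≤ m + 1 by omega)]
    have hub : pos u (m + 1) = b := by rw [← hhit, ← hω, pos_append_of_le u η le_rfl]
    have hendu : endpoint u = b := by rw [← pos_eq_endpoint]; exact hub
    have hendζ : endpoint ζ = b - stepVec g := by
      apply eq_sub_of_add_eq
      rw [← endpoint_snoc, hu, hendu]
    have hposη : ∀ t, pos ω (m + 1 + t) = b + pos η t := fun t => by
      rw [← hω, pos_append_add u η t, pos_eq_endpoint, hendu]
    -- non-backtracking pieces
    have hN := (isNBW_append_iff u η).1 (by rw [hω]; exact hnbw)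
    obtain ⟨hU, hV, hJ⟩ := hN
    have hZ := ((isNBW_snoc_iff ζ g).1 (by rw [hu]; exact hU)).1
    refine ⟨⟨g, ζ, η⟩, ?_, by
      show Fin.append (Fin.snoc ζ g : StepSeq d (m + 1)) η = ω
      rw [hu, hω]⟩
    rw [Finset.mem_sigma, Finset.mem_product]
    refine ⟨Finset.mem_univ _, ?_, ?_⟩
    · rw [mem_nbwAvoidTo]
      refine ⟨⟨hZ, fun t ht hA => ?_⟩, hendζ⟩
      rw [hposζ t ht] at hA
      rcases Finset.mem_insert.1 hA with h | h
      · exact hbefore t (by omega) h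
      · exact hav t (by omega) h
    · rw [mem_nbwAvoidToFirst]
      refine ⟨⟨⟨hV, fun t ht hA => ?_⟩, ?_⟩, fun j hj => ?_⟩
      · rw [mem_tabooShiftBy, add_comm, ← hposη t] at hA
        exact hav (m + 1 + t) (by omega) hA
      · apply eq_sub_of_add_eq
        rw [add_comm, ← hendu, ← endpoint_append, hω, hend]
      · have h1 := hJ ⟨m, by omega⟩ j rfl hj
        have e : u ⟨m, by omega⟩ = g := by
          rw [← hu]
          exact stepSeq_snoc_apply_eq ζ g rfl _
        rwa [e] at h1
  · rintro ⟨⟨g, ζ, η⟩, hp, rfl⟩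
    rw [Finset.mem_sigma, Finset.mem_product, mem_nbwAvoidTo, mem_nbwAvoidToFirst] at hp
    obtain ⟨-, ⟨⟨hZ, havζ⟩, hendζ⟩, ⟨⟨hV, havη⟩, hendη⟩, hfirst⟩ := hp
    have hendu : endpoint (Fin.snoc ζ g : StepSeq d (m + 1)) = b := by
      rw [endpoint_snoc, hendζ, sub_add_cancel]
    have hpos1 : ∀ t ≤ m, pos (Fin.append (Fin.snoc ζ g : StepSeq d (m + 1)) η : StepSeq d (m + 1 + k)) t = pos ζ t :=
      fun t ht => by rw [pos_append_of_le _ η (show t ≤ m + 1 by omega), pos_snoc_of_le ζ g ht]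
    have hpos2 : pos (Fin.append (Fin.snoc ζ g : StepSeq d (m + 1)) η : StepSeq d (m + 1 + k)) (m + 1) = b := by
      rw [pos_append_of_le _ η le_rfl, pos_eq_endpoint, hendu]
    have hpos3 : ∀ t, pos (Fin.append (Fin.snoc ζ g : StepSeq d (m + 1)) η : StepSeq d (m + 1 + k)) (m + 1 + t) =
        b + pos η t := fun t => by rw [pos_append_add _ η t, pos_eq_endpoint, hendu]
    -- `g` does not reverse the last step of `ζ`: otherwise `ζ` would sit on `b` one step before its end
    have hZg : IsNBW (Fin.snoc ζ g : StepSeq d (m + 1)) := by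
      rw [isNBW_snoc_iff]
      refine ⟨hZ, fun i hi h => ?_⟩
      have h1 := pos_succ ζ i.2
      rw [Fin.eta, h, stepVec_srev, hi, pos_eq_endpoint, hendζ] at h1
      have h2 : pos ζ i = b := by
        have := h1; rw [sub_eq_add_neg, add_right_cancel_iff] at this; exact this.symm
      exact havζ i (by omega) (h2 ▸ Finset.mem_insert_self b A)
    refine ⟨⟨⟨?_, fun t ht => ?_⟩, ?_⟩, hpos2, fun t ht => ?_⟩
    · rw [isNBW_append_iff]
      refine ⟨hZg, hV, fun i j hi hj => ?_⟩
      have e : (Fin.snoc ζ g : StepSeq d (m + 1)) i = g := by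
        have hi' : i = Fin.last m := Fin.ext (by simp only [Fin.val_last]; omega)
        rw [hi', Fin.snoc_last]
      rw [e]
      exact hfirst j hj
    · rcases Nat.lt_or_ge t (m + 1) with h1 | h1
      · rw [hpos1 t (by omega)]
        exact fun hA => havζ t (by omega) (Finset.mem_insert_of_mem hA)
      · obtain ⟨s, rfl⟩ : ∃ s, t = m + 1 + s := ⟨t - (m + 1), by omega⟩
        rcases Nat.eq_zero_or_pos s with hs | hs
        · rw [hs, add_zero, hpos2]
          exact hbA
        · rw [hpos3 s]
          intro hA
          refine havη s (by omega) ?_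
          rw [mem_tabooShiftBy, add_comm]
          exact hA
    · rw [endpoint_append, hendu, hendη, add_sub_cancel]
    · rw [hpos1 t (by omega)]
      exact fun h => havζ t (by omega) (h ▸ Finset.mem_insert_self b A)

/-- **(3.11) counted**: `#nbwFirstHit A b x (m+1+k) (m+1) = Σ_g c_m(A ∪ {b}, b − e_g) · N_k(A − b, x − b, −g)` for `b ∉ A`.
[cite: HaraSladeSokal1993, §3.2 eq. (3.11) p. 18] -/
theorem card_nbwFirstHit {A : Finset (Site d)} {b : Site d} (hbA : b ∉ A) (x : Site d) (m k : ℕ) :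
    (nbwFirstHit A b x (m + 1 + k) (m + 1)).card =
      ∑ g : Dir d, (nbwAvoidTo (insert b A) (b - stepVec g) m).card *
        (nbwAvoidToFirst (tabooShiftBy A b) (x - b) (srev g) k).card := by
  classical
  rw [nbwFirstHit_eq_image hbA x m k, Finset.card_image_of_injective _ (append_snoc_injective m k),
    Finset.card_sigma]
  exact Finset.sum_congr rfl fun g _ => Finset.card_product _ _

/-! ### (3.10) + (3.11): the first-hit expansion of `c_n(A, x)` -/

/-- **The first-hit expansion, coefficient level**: for `b ≠ 0`, `b ∉ A` and every `n`,
`c_n(A,x) = c_n(A ∪ {b}, x) + Σ_{m<n} Σ_g c_m(A ∪ {b}, b − e_g) · N_{n−1−m}(A − b, x − b, −g)` — the coefficient of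
`βⁿ` in (3.10)–(3.11) with `y = 0`. [cite: HaraSladeSokal1993, §3.2 eq. (3.10)–(3.11), (3.13) p. 17–18] -/
theorem card_nbwAvoidTo_first_hit_expansion {A : Finset (Site d)} {b : Site d} (hb0 : b ≠ 0) (hbA : b ∉ A)
    (x : Site d) (n : ℕ) :
    (nbwAvoidTo A x n).card = (nbwAvoidTo (insert b A) x n).card +
      ∑ m ∈ range n, ∑ g : Dir d, (nbwAvoidTo (insert b A) (b - stepVec g) m).card *
        (nbwAvoidToFirst (tabooShiftBy A b) (x - b) (srev g) (n - 1 - m)).card := by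
  rw [card_nbwAvoidTo_eq_card_insert_add_sum hb0 x n]
  congr 1
  refine Finset.sum_congr rfl fun m hm => ?_
  rw [Finset.mem_range] at hm
  rw [card_nbwFirstHit_congr (show n = m + 1 + (n - 1 - m) by omega), card_nbwFirstHit hbA]

/-- **The first-hit expansion for truncated generating functions** (exact, triangular truncation): for `b ≠ 0`,
`b ∉ A`, every `β` and `K`,
`Σ_{n≤K+1} c_n(A,x) βⁿ = Σ_{n≤K+1} c_n(A∪{b},x) βⁿ + β · Σ_g Σ_{m≤K} c_m(A∪{b}, b−e_g) β^m · Σ_{k≤K−m} N_k(A−b, x−b, −g) β^k`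
— (3.10)–(3.11) before the limit `K → ∞`; with (3.12) for the inner sums this is (3.13).
[cite: HaraSladeSokal1993, §3.2 eq. (3.13) p. 18] -/
theorem sum_card_nbwAvoidTo_mul_pow_eq {A : Finset (Site d)} {b : Site d} (hb0 : b ≠ 0) (hbA : b ∉ A)
    (x : Site d) (β : ℝ) (K : ℕ) :
    ∑ n ∈ range (K + 2), ((nbwAvoidTo A x n).card : ℝ) * β ^ n =
      ∑ n ∈ range (K + 2), ((nbwAvoidTo (insert b A) x n).card : ℝ) * β ^ n +
        β * ∑ g : Dir d, ∑ m ∈ range (K + 1), ((nbwAvoidTo (insert b A) (b - stepVec g) m).card : ℝ) * β ^ m *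
          ∑ k ∈ range (K + 1 - m), ((nbwAvoidToFirst (tabooShiftBy A b) (x - b) (srev g) k).card : ℝ) * β ^ k := by
  -- coefficientwise expansion, cast to `ℝ`
  have hcoef : ∀ n, ((nbwAvoidTo A x n).card : ℝ) * β ^ n =
      ((nbwAvoidTo (insert b A) x n).card : ℝ) * β ^ n +
        (∑ m ∈ range n, ∑ g : Dir d, ((nbwAvoidTo (insert b A) (b - stepVec g) m).card : ℝ) *
          ((nbwAvoidToFirst (tabooShiftBy A b) (x - b) (srev g) (n - 1 - m)).card : ℝ)) * β ^ n := fun n => by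
    rw [card_nbwAvoidTo_first_hit_expansion hb0 hbA x n]
    push_cast
    ring
  simp_rw [hcoef, Finset.sum_add_distrib]
  congr 1
  -- peel off `n = 0` (empty inner sum) and shift `n = n' + 1`
  rw [Finset.sum_range_succ' _ (K + 1)]
  simp only [Finset.range_zero, Finset.sum_empty, zero_mul, add_zero]
  -- swap the sums over `m` and `g`, and distribute `β^{n'+1} = β · β^m · β^{n'-m}`
  have hswap : ∀ n' : ℕ, (∑ m ∈ range (n' + 1), ∑ g : Dir d,
      ((nbwAvoidTo (insert b A) (b - stepVec g) m).card : ℝ) *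
        ((nbwAvoidToFirst (tabooShiftBy A b) (x - b) (srev g) (n' + 1 - 1 - m)).card : ℝ)) * β ^ (n' + 1) =
      β * ∑ g : Dir d, ∑ m ∈ range (n' + 1),
        ((nbwAvoidTo (insert b A) (b - stepVec g) m).card : ℝ) * β ^ m *
          (((nbwAvoidToFirst (tabooShiftBy A b) (x - b) (srev g) (n' - m)).card : ℝ) * β ^ (n' - m)) := fun n' => by
    rw [Finset.sum_comm, Finset.sum_mul, Finset.mul_sum]
    refine Finset.sum_congr rfl fun g _ => ?_
    rw [Finset.sum_mul, Finset.mul_sum]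
    refine Finset.sum_congr rfl fun m hm => ?_
    rw [Finset.mem_range] at hm
    have e : β ^ (n' + 1) = β * (β ^ m * β ^ (n' - m)) := by
      rw [← pow_add, Nat.add_sub_cancel' (by omega : m ≤ n'), pow_succ']
    rw [show n' + 1 - 1 - m = n' - m by omega, e]
    ring
  simp_rw [hswap]
  rw [← Finset.mul_sum, Finset.sum_comm]
  congr 1
  refine Finset.sum_congr rfl fun g _ => ?_
  exact sum_sum_range_convolution K (fun m => ((nbwAvoidTo (insert b A) (b - stepVec g) m).card : ℝ) * β ^ m)
    fun m k => ((nbwAvoidToFirst (tabooShiftBy A b) (x - b) (srev g) k).card : ℝ) * β ^ k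

end Literature.Probability.RandomPlanarGeometry.SAW.Zd.LoopErasure

end
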